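import Literature.MathematicalPhysics.QuantumFieldTheory.Balaban1983to89.T3CruxEstimates
import Literature.MathematicalPhysics.QuantumFieldTheory.Balaban1983to89.T3HeightwiseDensityBounds
import Summits.QuantumFields.YangMills.Theorems.UnitScaleTiltFluctuationComparisonRegPrSmallFieldRecursion
import HarnessLib

/-!
# LINE g23-2 «history_split» — THE STOPPED-FLOW SPLIT OF THE STABILITY PAIR: UP∘ ⟸ UPˢ∘ + UPᴸ∘ (small-history term + large-history
# terms, a.e. ADDITIVITY of the restricted densities in the event), LOWB∘ ⟸ LOWˢ∘ (small-history term alone, a.e. MONOTONICITY) —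
# organ-level line on crux `UnitScaleTilt.FluctuationComparisonRegPrIntL` (stmt-QuantumFields-20520; rung R3 `T3YM3TorusStatement.YM3TorusSU2`), lens «control»

Seat `ym-r3-idea-1` (D-0145 ideator, generation g23), cell `ym3-torus`.  PUBLISHED, NOT REGISTERED (★★OWNER RULING №36 (3)).
**HONESTY.**  Nothing of Bałaban's is asserted: the three rows below are `sorry`d STUBS (hypothesis schemas), NOT proved; UP∘, LOWB∘, PERS₁∘,
TUBE∘, POS∘, 20520, `YM3TorusSU2` are NOT proved; rung R3 is continuum SU(2) Yang–Mills on T³ — NOT d = 4, NOT infinite volume, NOT a mass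
gap, NOT the Clay problem; no summit is proved by a line.

## The control reading (lens «control»: a stopping structure along the RG flow)

LINE g23-1 `Lines/stability_letters.lean` reduced the organ's persistence row PERS₁∘ to the STABILITY PAIR {UP∘, LOWB∘} = [Balaban1985UV3]
Theorem 1 (5)+(6) at ONE height `n` in the quotient currency `Z_K⁻¹ρ_{K−n} = Z_K⁻¹·heightDensity F γ (n ≤ K) univ` (v1.1 §5, through
✓p765564; junction of record for ⟨UP⟩: LEAD w3's ✓`…PersistenceFromHeightwiseBounds`).  Bałaban proves (5) through the decomposition of unity
(7) p.257 «1 = Π_p [χ_p + χ_pᶜ]» applied at EVERY renormalization step: `ρ_k = Σ_terms`, one term per LARGE-FIELD HISTORY (the sets `P_j` of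
plaquettes where `χᶜ` was chosen at step `j`), the term with NO large field anywhere being the SMALL-FIELD TERM whose two-sided envelope is
(41) p.266 ∕ (47) p.267, the others being the output of the 𝐑-operation ((38)–(40) p.266, [Balaban1989LargeFieldI-II]).  On the tree the
histories are EVENTS of the fine field: `histGood F ℰp θ K n = {U | every remembered height K, K−1, …, n of the run-K tower of U is
θ-small}` (`T3UnitScaleTilt.histGood`; [Balaban1985UV3] (7) with `χ_k` at every level), and the terms are the tree's RESTRICTED DENSITIES
`heightDensity F γ hK S` = `T_{K−n−1}⋯T_0(1_S·e^{−β_K A})` read at height `n` (`T3TiltDescent.heightDensity`, `T3RestrictedUnitDensity.resDensity`) —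
THE CRUX'S OWN CURRENCY: 20520 compares `log ρ^{histGood,(K+1)} − log ρ^{histGood,(K)}`.  The CONTROLLING STRUCTURE of this line is the
STOPPING decomposition of the flow by its first exit from the window: `ρ^{univ} = ρ^{histGood} + ρ^{histGoodᶜ}` almost everywhere (§0,
PROVED: the restricted densities are a.e. ADDITIVE over disjoint events and a.e. MONOTONE in the event — the push-forward identity (2)∕(6) with
set-indicator test functions + `ae_eq_of_forall_setIntegral_eq`), so that

* the LOWER letter needs ONLY the no-exit trajectory: LOWB∘ ⟸ LOWˢ∘ (`ρ^{univ} ≥ ρ^{histGood}` a.e.; print p.257: «we make only few remarks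
  about the easier lower bound» — the lower bound is proved by DROPPING all large-field terms by positivity and bounding the small-field term
  from below, (47));
* the UPPER letter is the no-exit envelope PLUS the exit budget: UP∘ ⟸ UPˢ∘ + UPᴸ∘ (`ρ^{univ} = ρ^{histGood} + ρ^{histGoodᶜ}` a.e.; (41) for the
  first, the 𝐑-operation's bounds summed over the large-field histories for the second).

## What this file proves (kernel-checked, 0 sorry outside the three stubs)

* §0 (generic, tree-quality): `setIntegral_resDensity` (∫_A ρ^S_k = ∫_{S ∩ (Ū^k)⁻¹A} e^{−β_K A}), `resDensity_union_ae` (disjoint `S, S'`: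
  `ρ^{S∪S'}_k = ρ^S_k + ρ^{S'}_k` a.e.), `resDensity_mono_ae` (`S ⊆ T ⇒ ρ^S_k ≤ ρ^T_k` a.e.), `resDensity_univ_ae_eq_add_compl`, and the height-`n`
  readings `heightDensity_univ_ae_eq_add_compl`, `heightDensity_mono_ae` — reusable by the LFG∕S2β lines (`ρ = ρ^{hg}·Ξ` starts from this split);
  DEDUP: monotonicity is ALSO derived through the tree's name (`resDensity_mono_ae'` := crux-19201's ✓`LogComparisonSmallFieldRecursion.towerDensity_mono_ae`,
  imported); the ADDITIVITY lemmas are new in the tree;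
* §1 rows of record VERBATIM from LINE g23-1 (`Lines/stability_letters.lean` ll.89–113): UP∘ `StabilityUpperCan`, LOWB∘ `StabilityLowerWindowCan`;
* §3b (v1.1, critic #461 P1) the ACCOUNTING IDENTITY `stabilityUpper_iff_histories : UP∘ ↔ UPˢ∘ ∧ UPᴸ∘` (PROVED) — book TWO open letters, not three;
  §3c (P2) fixed-profile rows `StabilityLowerWindowAt`∕`SmallHistoryLowerWindowAt`, the junction at every profile, `θBal_profile_zero`, and the
  RECORDED weakness witness `LowerAntiReductionWitness` (constant-window profile `p₀ = 0`: LOWB∘-at holds, LOWˢ∘-at fails — print's prediction, NOT proved);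
* §2 the three NEW rows (stubs): UPˢ∘ `SmallHistoryUpperCan`, UPᴸ∘ `LargeHistoryUpperCan`, LOWˢ∘ `SmallHistoryLowerWindowCan` — all in the
  window-profile prefix of LOWB∘ (`∃` thresholds `bX pX`, `γ₁` after `(b₀,p₀)`, constant after `(F,γ,n)` before `K`);
* §3 ★ `stabilityUpper_of_histories : UPˢ∘ → UPᴸ∘ → UP∘` (profile instantiated at the joint thresholds, `C := Cs + Cl`, §0 additivity) and
  ★ `stabilityLowerWindow_of_smallHistory : LOWˢ∘ → LOWB∘` (same thresholds and `cl`, §0 monotonicity); by-name concluders from the stubs.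
  Docking BY TEXT: §1's two defs are byte-identical with g23-1's, whose ★★★ §5 takes them to PERS₁∘ and ★★ §4 (+ ⟨HAAR-TUBE₁⟩) to TUBE∘.

NET EFFECT ON THE ORGAN TREE: PERS₁∘ ⟸ {UPˢ∘, UPᴸ∘, LOWˢ∘}; the perturbative SMALL-FIELD pair {UPˢ∘, LOWˢ∘} ((41)∕(47): background field +
Gaussian fluctuation + convergent expansions in the analyticity domain, [Balaban1985UV3] Sect. B, [Balaban1987RG1], [Balaban1988RG2]) is
separated from the LARGE-FIELD budget UPᴸ∘ (𝐑-operation, [Balaban1985UV3] (38)–(40), [Balaban1989LargeFieldI-II]) — two different chapters of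
print, now two different rows.  WHY IT MIGHT FAIL (rows): UPˢ∘∕LOWˢ∘ — the tree's `histGood` uses SHARP characteristic functions at every level
with the window profile `θBal` of the DATUM (print's `χ_k` sit on the minimiser's plaquettes, (47)), so the small-field term's envelope needs the
datum-vs-minimiser conversion ([Balaban1985Variational] Thm 1; LEAD's ✓`regularityLetter_of_fibrePoint`∕`bounds5LowerOnSmall_of_minimiserShape`
type it); UPᴸ∘ — the sum over histories of the 𝐑-operation bounds must be K-UNIFORM: print's per-history factors `exp(−c·p(g_j)²|P_j|)` beat the
entropy `L^{3(j−n)}|T_n|` of the plaquettes of level `j` only because `p(g_j)² ≥ b₀²(1 + (j−n)log L∕2)^{2p₀}` grows super-linearly in `j`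
(`p₀ > 2`) — kernel-checked for the tree's `θBal` in LINE g22-3 `Lines/plaquette_tail.lean` §3 — and the R-operation itself is the deepest
part of the programme.  CHEAPEST FALSIFIER: instrument letter FL-8 (card): in the Gaussian∕FL-5 toy, the histGood-restricted marginal density
at the worst window datum vs the unrestricted one — the ratio `ρ^{hg}∕ρ^{univ}` on the window must be K-flat and bounded below (LOWˢ∘ ⟺ LOWB∘
up to a K-uniform factor), and `ρ^{hgᶜ}∕ρ^{univ}` must DEcrease with `b₀`.

References: T. Bałaban, CMP 102 (1985) 255–275 [Balaban1985UV3] ((2), (5)–(7) pp.256–257, Thm 1 p.257, (38)–(41) p.266, (47) p.267);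
CMP 109 (1987) 249–301 [Balaban1987RG1]; CMP 116 (1988) 1–22 [Balaban1988RG2]; CMP 122 (1989) 175–202 ∕ 355–392 [Balaban1989LargeFieldI-II];
CMP 102 (1985) 277–309 [Balaban1985Variational] (Thm 1).
-/

noncomputable section

set_option autoImplicit false

open MeasureTheory Filter Topology Set
open scoped ENNReal NNReal
open Literature.MathematicalPhysics.QuantumFieldTheory.Balaban1983to89
open Literature.MathematicalPhysics.QuantumFieldTheory.Balaban1983to89.T3ContinuumYM3Torus
open Literature.MathematicalPhysics.QuantumFieldTheory.Balaban1983to89.T3LevelShift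
open Literature.MathematicalPhysics.QuantumFieldTheory.Balaban1983to89.T3NestedUnitLaws
open Literature.MathematicalPhysics.QuantumFieldTheory.Balaban1983to89.T3UnitLawDensityEML
open Literature.MathematicalPhysics.QuantumFieldTheory.Balaban1983to89.T3UnitScaleTilt
open Literature.MathematicalPhysics.QuantumFieldTheory.Balaban1983to89.T3RestrictedUnitDensity
open Literature.MathematicalPhysics.QuantumFieldTheory.Balaban1983to89.T3TiltDescent
open Literature.MathematicalPhysics.QuantumFieldTheory.Balaban1983to89.T3CruxEstimates
open Literature.MathematicalPhysics.QuantumFieldTheory.Balaban1983to89.T3HeightwiseDensityBounds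
open Literature.MathematicalPhysics.QuantumFieldTheory.Balaban1983to89.Missing
open Literature.MathematicalPhysics.QuantumFieldTheory.Balaban1983to89.T4Continuum

namespace Summit.QuantumFields.YangMills.Cruxes.FluctuationComparisonRegPrIntL.HistorySplit

/-! ## §0 Restricted densities are a.e. ADDITIVE and MONOTONE in the restriction event (PROVED, generic) -/

section Additivity

variable {F : T3Family} {γ : ℝ} {K : ℕ}

/-- The `k`-fold printed averaging of run `K` is measurable (induction on `k`; one step = `measurable_blockAvg`).
[cite: Balaban1987RG1, (0.4) p.253 and (0.11) p.253] -/
theorem measurable_iterAvg (F : T3Family) (K : ℕ) :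
    ∀ k : ℕ, Measurable (Averaging.iter (fun i => BlockAveraging.blockAvg (P := F.P K) (j := i) ℰp) k)
  | 0 => measurable_id
  | k + 1 => (measurable_blockAvg F K k).comp (measurable_iterAvg F K k)

/-- **SET INTEGRALS OF A RESTRICTED DENSITY = RESTRICTED BOLTZMANN MASS OF THE PULLED-BACK EVENT**:
`∫_A ρ^S_k dV_k = ∫ 1_{S ∩ (Ū^k)⁻¹A}·e^{−β_K A} dU` ((2)∕(6) with the test function `1_A`). [cite: Balaban1985UV3, (2) p.256 and (6) p.257] -/
theorem setIntegral_resDensity {S : Set (GaugeField (F.P K) 0 (Matrix.specialUnitaryGroup (Fin 2) ℂ))} (hS : MeasurableSet S)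
    (hγ : 0 ≤ γ) {k : ℕ} (hk : k ≤ F.m + K) {A : Set (GaugeField (F.P K) k (Matrix.specialUnitaryGroup (Fin 2) ℂ))}
    (hA : MeasurableSet A) :
    ∫ V in A, resDensity F γ K S k V ∂fieldMeasure (F.P K) k (Matrix.specialUnitaryGroup (Fin 2) ℂ) =
      ∫ U, (S ∩ Averaging.iter (fun i => BlockAveraging.blockAvg (P := F.P K) (j := i) ℰp) k ⁻¹' A).indicator
          (boltzmann (F.P K) ((F.scheme ℰp γ).β K)) U ∂fieldMeasure (F.P K) 0 (Matrix.specialUnitaryGroup (Fin 2) ℂ) := by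
  have hb : ∀ W : GaugeField (F.P K) k (Matrix.specialUnitaryGroup (Fin 2) ℂ), |A.indicator (fun _ => (1 : ℝ)) W| ≤ 1 :=
    fun W => by by_cases hW : W ∈ A <;> simp [hW]
  have key := integral_resDensity_mul F K hS hγ hk (A.indicator (fun _ => (1 : ℝ))) (measurable_const.indicator hA) ⟨1, hb⟩
  rw [← integral_indicator hA]
  have h1 : (fun V => A.indicator (resDensity F γ K S k) V) =
      fun V => resDensity F γ K S k V * A.indicator (fun _ => (1 : ℝ)) V := by
    funext V
    by_cases hV : V ∈ A <;> simp [hV]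
  rw [h1, key]
  refine integral_congr_ae (Eventually.of_forall fun U => ?_)
  by_cases hU : U ∈ S
  · by_cases hUA : Averaging.iter (fun i => BlockAveraging.blockAvg (P := F.P K) (j := i) ℰp) k U ∈ A
    · have hmem : U ∈ S ∩ Averaging.iter (fun i => BlockAveraging.blockAvg (P := F.P K) (j := i) ℰp) k ⁻¹' A := ⟨hU, hUA⟩
      simp [Set.indicator_of_mem hU, Set.indicator_of_mem hUA, Set.indicator_of_mem hmem]
    · have hnm : U ∉ S ∩ Averaging.iter (fun i => BlockAveraging.blockAvg (P := F.P K) (j := i) ℰp) k ⁻¹' A := fun h => hUA h.2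
      simp [Set.indicator_of_notMem hUA, Set.indicator_of_notMem hnm]
  · have hnm : U ∉ S ∩ Averaging.iter (fun i => BlockAveraging.blockAvg (P := F.P K) (j := i) ℰp) k ⁻¹' A := fun h => hU h.1
    simp [Set.indicator_of_notMem hU, Set.indicator_of_notMem hnm]

/-- The restricted Boltzmann weight on a measurable event is integrable against fine product Haar. [cite: Balaban1985UV3, (1) p.256] -/
theorem integrable_indicator_boltzmann (hγ : 0 ≤ γ) {E : Set (GaugeField (F.P K) 0 (Matrix.specialUnitaryGroup (Fin 2) ℂ))}
    (hE : MeasurableSet E) :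
    Integrable (E.indicator (boltzmann (F.P K) ((F.scheme ℰp γ).β K))) (fieldMeasure (F.P K) 0 (Matrix.specialUnitaryGroup (Fin 2) ℂ)) :=
  (integrable_boltzmann RegularGaugeGroup.measurable_reTr _ (F.scheme_β_nonneg ℰp hγ K)).indicator hE

/-- **A.E. ADDITIVITY OVER DISJOINT EVENTS**: `ρ^{S ∪ S'}_k = ρ^S_k + ρ^{S'}_k` for `dV_k`-almost every `V` (`S, S'` measurable and disjoint) —
the decomposition of unity (7) read on the renormalised densities: the density of the whole is the sum of its terms.
[cite: Balaban1985UV3, (7) p.257 and (2) p.256] -/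
theorem resDensity_union_ae {S S' : Set (GaugeField (F.P K) 0 (Matrix.specialUnitaryGroup (Fin 2) ℂ))} (hS : MeasurableSet S)
    (hS' : MeasurableSet S') (hd : Disjoint S S') (hγ : 0 ≤ γ) {k : ℕ} (hk : k ≤ F.m + K) :
    ∀ᵐ V ∂fieldMeasure (F.P K) k (Matrix.specialUnitaryGroup (Fin 2) ℂ),
      resDensity F γ K (S ∪ S') k V = resDensity F γ K S k V + resDensity F γ K S' k V := by
  have hint := integrable_resDensity F K (hS.union hS') hγ hk
  have hintS := integrable_resDensity F K hS hγ hk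
  have hintS' := integrable_resDensity F K hS' hγ hk
  have h := Integrable.ae_eq_of_forall_setIntegral_eq _ _ hint (hintS.add hintS') fun A hA _ => by
    simp only [Pi.add_apply]
    rw [integral_add hintS.integrableOn hintS'.integrableOn, setIntegral_resDensity (hS.union hS') hγ hk hA,
      setIntegral_resDensity hS hγ hk hA, setIntegral_resDensity hS' hγ hk hA,
      ← integral_add (integrable_indicator_boltzmann hγ (hS.inter (hA.preimage (measurable_iterAvg F K k))))
        (integrable_indicator_boltzmann hγ (hS'.inter (hA.preimage (measurable_iterAvg F K k))))]
    refine integral_congr_ae (Eventually.of_forall fun U => ?_)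
    have hd' : Disjoint (S ∩ Averaging.iter (fun i => BlockAveraging.blockAvg (P := F.P K) (j := i) ℰp) k ⁻¹' A)
        (S' ∩ Averaging.iter (fun i => BlockAveraging.blockAvg (P := F.P K) (j := i) ℰp) k ⁻¹' A) :=
      hd.mono Set.inter_subset_left Set.inter_subset_left
    simp only [Set.union_inter_distrib_right, Set.indicator_union_of_disjoint hd']
  filter_upwards [h] with V hV
  simpa using hV

/-- **THE STOPPED-FLOW SPLIT**: `ρ_k = ρ^S_k + ρ^{Sᶜ}_k` almost everywhere, for every measurable event `S` of the fine field — with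
`S = histGood` this is «density = small-field term + all large-field terms» of (7). [cite: Balaban1985UV3, (7) p.257] -/
theorem resDensity_univ_ae_eq_add_compl {S : Set (GaugeField (F.P K) 0 (Matrix.specialUnitaryGroup (Fin 2) ℂ))} (hS : MeasurableSet S)
    (hγ : 0 ≤ γ) {k : ℕ} (hk : k ≤ F.m + K) :
    ∀ᵐ V ∂fieldMeasure (F.P K) k (Matrix.specialUnitaryGroup (Fin 2) ℂ),
      resDensity F γ K Set.univ k V = resDensity F γ K S k V + resDensity F γ K Sᶜ k V := by
  have h := resDensity_union_ae hS hS.compl disjoint_compl_right hγ hk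
  rw [Set.union_compl_self] at h
  exact h

/-- **A.E. MONOTONICITY IN THE EVENT**: `S ⊆ T ⇒ ρ^S_k ≤ ρ^T_k` almost everywhere (additivity over `T = S ∪ (T \ S)` + `ρ ≥ 0`): dropping
terms of (7) only decreases the density — the mechanism of the «easier lower bound» (p.257). [cite: Balaban1985UV3, (7) p.257 and (47) p.267] -/
theorem resDensity_mono_ae {S T : Set (GaugeField (F.P K) 0 (Matrix.specialUnitaryGroup (Fin 2) ℂ))} (hS : MeasurableSet S)
    (hT : MeasurableSet T) (hST : S ⊆ T) (hγ : 0 ≤ γ) {k : ℕ} (hk : k ≤ F.m + K) :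
    ∀ᵐ V ∂fieldMeasure (F.P K) k (Matrix.specialUnitaryGroup (Fin 2) ℂ), resDensity F γ K S k V ≤ resDensity F γ K T k V := by
  have h := resDensity_union_ae hS (hT.diff hS) Set.disjoint_sdiff_right hγ hk
  rw [Set.union_diff_cancel hST] at h
  filter_upwards [h] with V hV
  rw [hV]
  exact le_add_of_nonneg_right (resDensity_nonneg F γ K _ k V)

/-- DEDUP (the same monotonicity THROUGH THE TREE'S NAME): `S ⊆ T ⇒ resDensity S ≤ resDensity T` a.e. is the tree's monotone tower
✓`LogComparisonSmallFieldRecursion.towerDensity_mono_ae` (crux-19201 support file `…SmallFieldRecursion.lean` §4, [Balaban1985UV3] (41) p.266) applied to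
`1_S·e^{−β_K A} ≤ 1_T·e^{−β_K A}`; the ADDITIVITY `resDensity_union_ae` above is not in the tree. [cite: Balaban1985UV3, (41) p.266] -/
theorem resDensity_mono_ae' {S T : Set (GaugeField (F.P K) 0 (Matrix.specialUnitaryGroup (Fin 2) ℂ))} (hS : MeasurableSet S)
    (hT : MeasurableSet T) (hST : S ⊆ T) (hγ : 0 ≤ γ) {k : ℕ} (hk : k ≤ F.m + K) :
    ∀ᵐ V ∂fieldMeasure (F.P K) k (Matrix.specialUnitaryGroup (Fin 2) ℂ), resDensity F γ K S k V ≤ resDensity F γ K T k V :=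
  Summit.QuantumFields.YangMills.Theorems.LogComparisonSmallFieldRecursion.towerDensity_mono_ae F K
    (integrable_indicator_boltzmann hγ hS) (integrable_indicator_boltzmann hγ hT)
    (Filter.Eventually.of_forall fun U =>
      Set.indicator_le_indicator_of_subset hST (fun U => (boltzmann_pos _ _ U).le) U) k hk

/-- **THE SPLIT AT THE COMPARISON HEIGHT**: `heightDensity univ = heightDensity S + heightDensity Sᶜ` `dU_n`-a.e. (transport of
`resDensity_univ_ae_eq_add_compl` along the measure-preserving level identification `fieldShift`). [cite: Balaban1985UV3, (7) p.257] -/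
theorem heightDensity_univ_ae_eq_add_compl {n : ℕ} (hK : n ≤ K) {S : Set (GaugeField (F.P K) 0 (Matrix.specialUnitaryGroup (Fin 2) ℂ))}
    (hS : MeasurableSet S) (hγ : 0 ≤ γ) :
    ∀ᵐ V ∂fieldMeasure (F.P n) 0 (Matrix.specialUnitaryGroup (Fin 2) ℂ),
      heightDensity F γ hK Set.univ V = heightDensity F γ hK S V + heightDensity F γ hK Sᶜ V := by
  have hae := resDensity_univ_ae_eq_add_compl (F := F) hS hγ (k := K - n) (by omega)
  have hmp := measurePreserving_fieldShift (G := Matrix.specialUnitaryGroup (Fin 2) ℂ)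
    (F.sitesPerDir_eq (m := F.m) (K := K) (j := K - n) (m' := F.m) (K' := n) (j' := 0) (by omega))
  filter_upwards [hmp.quasiMeasurePreserving.ae hae] with V hV
  exact hV

/-- **MONOTONICITY AT THE COMPARISON HEIGHT**: `S ⊆ T ⇒ heightDensity S ≤ heightDensity T` `dU_n`-a.e. [cite: Balaban1985UV3, (7) p.257] -/
theorem heightDensity_mono_ae {n : ℕ} (hK : n ≤ K) {S T : Set (GaugeField (F.P K) 0 (Matrix.specialUnitaryGroup (Fin 2) ℂ))}
    (hS : MeasurableSet S) (hT : MeasurableSet T) (hST : S ⊆ T) (hγ : 0 ≤ γ) :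
    ∀ᵐ V ∂fieldMeasure (F.P n) 0 (Matrix.specialUnitaryGroup (Fin 2) ℂ), heightDensity F γ hK S V ≤ heightDensity F γ hK T V := by
  have hae := resDensity_mono_ae (F := F) hS hT hST hγ (k := K - n) (by omega)
  have hmp := measurePreserving_fieldShift (G := Matrix.specialUnitaryGroup (Fin 2) ℂ)
    (F.sitesPerDir_eq (m := F.m) (K := K) (j := K - n) (m' := F.m) (K' := n) (j' := 0) (by omega))
  filter_upwards [hmp.quasiMeasurePreserving.ae hae] with V hV
  exact hV

end Additivity

/-! ## §1 Rows of record, VERBATIM from LINE g23-1 `Lines/stability_letters.lean` (by-text docking; NOT proved) -/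

/-- ROW UP∘ (VERBATIM, g23-1 l.89): the tree schema `HeightwiseUpperBound F γ` ([Balaban1985UV3] (5) upper ∕ (6)) under a per-`L` coupling
threshold.  Hypothesis schema; NOT proved. [cite: Balaban1985UV3, (5)-(6) pp.256-257 and Thm 1 p.257] -/
def StabilityUpperCan : Prop :=
  ∀ (L : ℕ), ∃ γ₁ : ℝ, 0 < γ₁ ∧ ∀ (F : T3Family) (γ : ℝ), F.L = L → 0 < γ → γ ≤ γ₁ → HeightwiseUpperBound F γ

/-- ROW LOWB∘ (VERBATIM, g23-1 l.105): the (5)-lower ∕ (6) floor on Bałaban's window at every height, thresholds `bB pB`, `γ₁` after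
`(b₀,p₀)`, `cl` after `(F,γ,n)` before `K`.  Hypothesis schema; NOT proved. [cite: Balaban1985UV3, (4)-(5) p.256, (7) p.257 and (47) p.267] -/
def StabilityLowerWindowCan : Prop :=
  ∀ (L : ℕ), ∃ bB pB : ℝ, ∀ (b₀ p₀ : ℝ), bB ≤ b₀ → pB ≤ p₀ →
    ∃ γ₁ : ℝ, 0 < γ₁ ∧ ∀ (F : T3Family) (γ : ℝ), F.L = L → 0 < γ → γ ≤ γ₁ →
      ∀ (n : ℕ), ∃ cl : ℝ, 0 < cl ∧ ∀ (K : ℕ) (hK : n ≤ K),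
        ∀ᵐ V ∂(fieldMeasure (F.P n) 0 (Matrix.specialUnitaryGroup (Fin 2) ℂ)),
          PlaqSmall (θBal F.L γ b₀ p₀ n) V →
            cl ≤ (partitionFn (G := Matrix.specialUnitaryGroup (Fin 2) ℂ) (F.P K) ((F.scheme ℰp γ).β K))⁻¹ *
              heightDensity F γ hK Set.univ V

/-! ## §2 The three new rows (stubs; hypothesis schemas, NOT proved) -/

/-- ROW UPˢ∘ **SMALL-HISTORY ENVELOPE, UPPER** ([Balaban1985UV3] (41) p.266 over (6): the small-field term of (7) iterated — the fine fields
whose run-`K` tower is `θBal(b₀,p₀)`-small at every remembered height `K, …, n` — has a `K`-UNIFORM sup in the quotient currency): for every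
`L` there are thresholds `bU pU` such that for `b₀ ≥ bU`, `p₀ ≥ pU` there is `γ₁ > 0` with, for every family (`F.L = L`), `0 < γ ≤ γ₁` and
height `n`, ONE constant `C` such that `Z_K⁻¹·heightDensity F γ hK (histGood F ℰp (θBal F.L γ b₀ p₀) K n) ≤ C` `dU_n`-a.e., for EVERY run
`K ≥ n`.  Perturbative: background field + Gaussian fluctuation in the analyticity domain ([Balaban1985UV3] Sect. B, [Balaban1987RG1]).
Why it might fail: sharp `χ` at every level with the DATUM's window profile (print's `χ_k` sit on the minimiser's plaquettes, (47)).
Hypothesis schema; NOT proved. [cite: Balaban1985UV3, (7) p.257, (41) p.266 and (6) p.257; Balaban1987RG1, (0.18)-(0.22) p.255] -/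
def SmallHistoryUpperCan : Prop :=
  ∀ (L : ℕ), ∃ bU pU : ℝ, ∀ (b₀ p₀ : ℝ), bU ≤ b₀ → pU ≤ p₀ →
    ∃ γ₁ : ℝ, 0 < γ₁ ∧ ∀ (F : T3Family) (γ : ℝ), F.L = L → 0 < γ → γ ≤ γ₁ →
      ∀ (n : ℕ), ∃ C : ℝ, ∀ (K : ℕ) (hK : n ≤ K),
        ∀ᵐ V ∂(fieldMeasure (F.P n) 0 (Matrix.specialUnitaryGroup (Fin 2) ℂ)),
          (partitionFn (G := Matrix.specialUnitaryGroup (Fin 2) ℂ) (F.P K) ((F.scheme ℰp γ).β K))⁻¹ *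
              heightDensity F γ hK (histGood F ℰp (θBal F.L γ b₀ p₀) K n) V ≤ C

theorem stub_smallHistoryUpper : SmallHistoryUpperCan := by
  sorry

/-- ROW UPᴸ∘ **LARGE-HISTORY BUDGET** ([Balaban1985UV3] (38)–(40) p.266 summed over the large-field histories, over (6): the part of the
density carried by fine fields that LEAVE the window at some remembered height has a `K`-UNIFORM sup in the quotient currency): same prefix
with thresholds `bL pL`, bound `Z_K⁻¹·heightDensity F γ hK (histGood F ℰp (θBal F.L γ b₀ p₀) K n)ᶜ ≤ C` `dU_n`-a.e. for every `K ≥ n`.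
Print gives more (each history's term carries `exp(−c·p(g_j)²·|P_j|)`, so the budget even tends to `0` as `b₀ → ∞`); the row keeps the part
UP∘ needs.  Why it might fail: K-uniformity of the SUM over histories — the per-level factors `exp(−c·p(g_j)²)` must beat the entropy
`3·L^{3(j−n)}|T_n|` of level-`j` plaquettes for all `j ≤ K` at once (true for `θBal` since `p₀ > 2`: LINE g22-3 `plaquette_tail.lean` §3),
and the 𝐑-operation ([Balaban1989LargeFieldI-II]) is the deepest chapter of the programme.  Hypothesis schema; NOT proved.
[cite: Balaban1985UV3, (7) p.257 and (38)-(40) p.266; Balaban1989LargeFieldII, (1.72) p.372 and (1.97)-(1.100) p.379] -/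
def LargeHistoryUpperCan : Prop :=
  ∀ (L : ℕ), ∃ bL pL : ℝ, ∀ (b₀ p₀ : ℝ), bL ≤ b₀ → pL ≤ p₀ →
    ∃ γ₁ : ℝ, 0 < γ₁ ∧ ∀ (F : T3Family) (γ : ℝ), F.L = L → 0 < γ → γ ≤ γ₁ →
      ∀ (n : ℕ), ∃ C : ℝ, ∀ (K : ℕ) (hK : n ≤ K),
        ∀ᵐ V ∂(fieldMeasure (F.P n) 0 (Matrix.specialUnitaryGroup (Fin 2) ℂ)),
          (partitionFn (G := Matrix.specialUnitaryGroup (Fin 2) ℂ) (F.P K) ((F.scheme ℰp γ).β K))⁻¹ *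
              heightDensity F γ hK (histGood F ℰp (θBal F.L γ b₀ p₀) K n)ᶜ V ≤ C

theorem stub_largeHistoryUpper : LargeHistoryUpperCan := by
  sorry

/-- ROW LOWˢ∘ **SMALL-HISTORY ENVELOPE, LOWER, ON THE WINDOW** ([Balaban1985UV3] (47) p.267 over (6) — «the easier lower bound»: the
small-field term ALONE is bounded below on the window): for every `L` there are thresholds `bB pB` such that for `b₀ ≥ bB`, `p₀ ≥ pB` there
is `γ₁ > 0` with, for every family, `0 < γ ≤ γ₁` and height `n`, ONE `cl > 0` such that for every run `K ≥ n`, `dU_n`-a.e. on the window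
`{PlaqSmall (θBal F.L γ b₀ p₀ n)}`: `cl ≤ Z_K⁻¹·heightDensity F γ hK (histGood F ℰp (θBal F.L γ b₀ p₀) K n)`.  This STRENGTHENS the crux's own
positivity conjunct `0 < heightDensity … (histGood …) V` (20520's `BgFluctuationIntAt`, on the `c`-interior) to a `K`-uniform floor.  Why it
might fail: as UPˢ∘ (datum-`χ` vs minimiser-`χ_k`), plus the floor must survive the sharp cut-offs at EVERY intermediate level (the
conditional probability, given a window datum, that all finer levels stay in their windows is bounded below only because the same
super-linear `p(g_j)²` kills the union over levels).  Hypothesis schema; NOT proved.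
[cite: Balaban1985UV3, (4)-(5) p.256, (7) p.257 and (47) p.267; Balaban1985Variational, Thm 1 p.279] -/
def SmallHistoryLowerWindowCan : Prop :=
  ∀ (L : ℕ), ∃ bB pB : ℝ, ∀ (b₀ p₀ : ℝ), bB ≤ b₀ → pB ≤ p₀ →
    ∃ γ₁ : ℝ, 0 < γ₁ ∧ ∀ (F : T3Family) (γ : ℝ), F.L = L → 0 < γ → γ ≤ γ₁ →
      ∀ (n : ℕ), ∃ cl : ℝ, 0 < cl ∧ ∀ (K : ℕ) (hK : n ≤ K),
        ∀ᵐ V ∂(fieldMeasure (F.P n) 0 (Matrix.specialUnitaryGroup (Fin 2) ℂ)),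
          PlaqSmall (θBal F.L γ b₀ p₀ n) V →
            cl ≤ (partitionFn (G := Matrix.specialUnitaryGroup (Fin 2) ℂ) (F.P K) ((F.scheme ℰp γ).β K))⁻¹ *
              heightDensity F γ hK (histGood F ℰp (θBal F.L γ b₀ p₀) K n) V

theorem stub_smallHistoryLowerWindow : SmallHistoryLowerWindowCan := by
  sorry

/-! ## §3 The junctions (PROVED): UP∘ ⟸ UPˢ∘ + UPᴸ∘ (additivity), LOWB∘ ⟸ LOWˢ∘ (monotonicity) -/

/-- ★ **UP∘ ⟸ UPˢ∘ + UPᴸ∘**: at the joint thresholds `(max bU bL, max pU pL)` (UP∘ is profile-free, so ANY admissible profile serves) and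
`γ₁ := min γU γL`, with `C := Cs + Cl`: `Z⁻¹ρ^{univ} = Z⁻¹ρ^{hg} + Z⁻¹ρ^{hgᶜ} ≤ Cs + Cl` a.e. (§0 `heightDensity_univ_ae_eq_add_compl`).
CONDITIONAL on the two rows; nothing of Bałaban's is proved. [cite: Balaban1985UV3, (7) p.257, (41) p.266 and (38)-(40) p.266] -/
theorem stabilityUpper_of_histories (hs : SmallHistoryUpperCan) (hl : LargeHistoryUpperCan) : StabilityUpperCan := by
  intro L
  obtain ⟨bU, pU, hsF⟩ := hs L
  obtain ⟨bL, pL, hlF⟩ := hl L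
  obtain ⟨γU, hγU, hs1⟩ := hsF (max bU bL) (max pU pL) (le_max_left _ _) (le_max_left _ _)
  obtain ⟨γL, hγL, hl1⟩ := hlF (max bU bL) (max pU pL) (le_max_right _ _) (le_max_right _ _)
  refine ⟨min γU γL, lt_min hγU hγL, fun F γ hFL hγ hγle n => ?_⟩
  obtain ⟨Cs, hCs⟩ := hs1 F γ hFL hγ (hγle.trans (min_le_left _ _)) n
  obtain ⟨Cl, hCl⟩ := hl1 F γ hFL hγ (hγle.trans (min_le_right _ _)) n
  refine ⟨Cs + Cl, fun K hK => ?_⟩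
  have hsplit := heightDensity_univ_ae_eq_add_compl (F := F) hK
    (measurableSet_histGood F ℰp measurableE_ℰp (θBal F.L γ (max bU bL) (max pU pL)) K n) hγ.le
  filter_upwards [hsplit, hCs K hK, hCl K hK] with V hV h1 h2
  rw [hV, mul_add]
  exact add_le_add h1 h2

/-- ★ **LOWB∘ ⟸ LOWˢ∘**: same thresholds, same `γ₁`, same `cl`: on the window `cl ≤ Z⁻¹ρ^{hg} ≤ Z⁻¹ρ^{univ}` a.e.
(§0 `heightDensity_mono_ae`, `Z_K > 0`).  CONDITIONAL on the row; nothing of Bałaban's is proved. [cite: Balaban1985UV3, (7) p.257 and (47) p.267] -/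
theorem stabilityLowerWindow_of_smallHistory (h : SmallHistoryLowerWindowCan) : StabilityLowerWindowCan := by
  intro L
  obtain ⟨bB, pB, hF⟩ := h L
  refine ⟨bB, pB, fun b₀ p₀ hb hp => ?_⟩
  obtain ⟨γ₁, hγ₁, h1⟩ := hF b₀ p₀ hb hp
  refine ⟨γ₁, hγ₁, fun F γ hFL hγ hγle n => ?_⟩
  obtain ⟨cl, hcl, h2⟩ := h1 F γ hFL hγ hγle n
  refine ⟨cl, hcl, fun K hK => ?_⟩
  have hmono := heightDensity_mono_ae (F := F) hK
    (measurableSet_histGood F ℰp measurableE_ℰp (θBal F.L γ b₀ p₀) K n) MeasurableSet.univ (Set.subset_univ _) hγ.le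
  have hZ : 0 ≤ (partitionFn (G := Matrix.specialUnitaryGroup (Fin 2) ℂ) (F.P K) ((F.scheme ℰp γ).β K))⁻¹ :=
    inv_nonneg.mpr (partitionFn_pos' _ (F.scheme_β_nonneg ℰp hγ.le K)).le
  filter_upwards [h2 K hK, hmono] with V hV hm hsm
  exact (hV hsm).trans (mul_le_mul_of_nonneg_left hm hZ)

/-! ## §3b ACCOUNTING (critic #461 P1, PROVED): the UPPER split is an EQUIVALENCE `UP∘ ↔ UPˢ∘ ∧ UPᴸ∘`; the line's logical content
is the LOWER junction.  Book the organ tree as PERS₁∘ ⟸ {UP∘ ≡ (UPˢ∘ ∧ UPᴸ∘), LOWˢ∘ (⊋ LOWB∘)} — TWO open letters' worth, not three. -/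

/-- UP∘ → UPˢ∘ (thresholds `(0,0)`, same `γ₁`, same `C`): `Z⁻¹ρ^{hg} ≤ Z⁻¹ρ^{univ} ≤ C` a.e. by §0 monotonicity on `histGood ⊆ univ`.
Accounting identity; nothing of Bałaban's is proved. [cite: Balaban1985UV3, (7) p.257] -/
theorem smallHistoryUpper_of_stabilityUpper (h : StabilityUpperCan) : SmallHistoryUpperCan := by
  intro L
  obtain ⟨γ₁, hγ₁, h1⟩ := h L
  refine ⟨0, 0, fun b₀ p₀ _ _ => ⟨γ₁, hγ₁, fun F γ hFL hγ hγle n => ?_⟩⟩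
  obtain ⟨C, hC⟩ := h1 F γ hFL hγ hγle n
  refine ⟨C, fun K hK => ?_⟩
  have hmono := heightDensity_mono_ae (F := F) hK
    (measurableSet_histGood F ℰp measurableE_ℰp (θBal F.L γ b₀ p₀) K n) MeasurableSet.univ (Set.subset_univ _) hγ.le
  have hZ : 0 ≤ (partitionFn (G := Matrix.specialUnitaryGroup (Fin 2) ℂ) (F.P K) ((F.scheme ℰp γ).β K))⁻¹ :=
    inv_nonneg.mpr (partitionFn_pos' _ (F.scheme_β_nonneg ℰp hγ.le K)).le
  filter_upwards [hC K hK, hmono] with V hV hm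
  exact (mul_le_mul_of_nonneg_left hm hZ).trans hV

/-- UP∘ → UPᴸ∘ (thresholds `(0,0)`, same `γ₁`, same `C`): `Z⁻¹ρ^{hgᶜ} ≤ Z⁻¹ρ^{univ} ≤ C` a.e. by §0 monotonicity on `histGoodᶜ ⊆ univ`.
Accounting identity; nothing of Bałaban's is proved. [cite: Balaban1985UV3, (7) p.257] -/
theorem largeHistoryUpper_of_stabilityUpper (h : StabilityUpperCan) : LargeHistoryUpperCan := by
  intro L
  obtain ⟨γ₁, hγ₁, h1⟩ := h L
  refine ⟨0, 0, fun b₀ p₀ _ _ => ⟨γ₁, hγ₁, fun F γ hFL hγ hγle n => ?_⟩⟩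
  obtain ⟨C, hC⟩ := h1 F γ hFL hγ hγle n
  refine ⟨C, fun K hK => ?_⟩
  have hmono := heightDensity_mono_ae (F := F) hK
    (measurableSet_histGood F ℰp measurableE_ℰp (θBal F.L γ b₀ p₀) K n).compl MeasurableSet.univ (Set.subset_univ _) hγ.le
  have hZ : 0 ≤ (partitionFn (G := Matrix.specialUnitaryGroup (Fin 2) ℂ) (F.P K) ((F.scheme ℰp γ).β K))⁻¹ :=
    inv_nonneg.mpr (partitionFn_pos' _ (F.scheme_β_nonneg ℰp hγ.le K)).le
  filter_upwards [hC K hK, hmono] with V hV hm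
  exact (mul_le_mul_of_nonneg_left hm hZ).trans hV

/-- ★ **ACCOUNTING IDENTITY** (critic #461 P1, = the critic's `crit_up_iff_histories`): `UP∘ ↔ UPˢ∘ ∧ UPᴸ∘`.  Neither upper row is a
weakening of the organ letter in the direction that matters; jointly they ARE UP∘.  Nothing of Bałaban's is proved. -/
theorem stabilityUpper_iff_histories : StabilityUpperCan ↔ SmallHistoryUpperCan ∧ LargeHistoryUpperCan :=
  ⟨fun h => ⟨smallHistoryUpper_of_stabilityUpper h, largeHistoryUpper_of_stabilityUpper h⟩,
   fun h => stabilityUpper_of_histories h.1 h.2⟩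

/-! ## §3c WEAKNESS WITNESS for the anti-reduction LOWB∘ ⟸ LOWˢ∘ (critic #461 P2; TYPED, print's prediction RECORDED, nothing proved).
The rows at a FIXED profile `(b₀, p₀)`; the separating instance is the CONSTANT-WINDOW profile `p₀ = 0`
(`θBal L γ b₀ 0 i = b₀·√(γ·L^{−i})`: a window of constant width `b₀` in units of the level-`i` coupling `g_i`, since `(1 + log g⁻¹)^0 = 1`). -/

/-- LOWB∘ at the fixed profile `(b₀, p₀)` (the organ letter's body without the threshold prefix). Schema; NOT asserted. -/
def StabilityLowerWindowAt (L : ℕ) (b₀ p₀ : ℝ) : Prop :=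
  ∃ γ₁ : ℝ, 0 < γ₁ ∧ ∀ (F : T3Family) (γ : ℝ), F.L = L → 0 < γ → γ ≤ γ₁ →
    ∀ (n : ℕ), ∃ cl : ℝ, 0 < cl ∧ ∀ (K : ℕ) (hK : n ≤ K),
      ∀ᵐ V ∂(fieldMeasure (F.P n) 0 (Matrix.specialUnitaryGroup (Fin 2) ℂ)),
        PlaqSmall (θBal F.L γ b₀ p₀ n) V →
          cl ≤ (partitionFn (G := Matrix.specialUnitaryGroup (Fin 2) ℂ) (F.P K) ((F.scheme ℰp γ).β K))⁻¹ *
            heightDensity F γ hK Set.univ V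

/-- LOWˢ∘ at the fixed profile `(b₀, p₀)`. Schema; NOT asserted. -/
def SmallHistoryLowerWindowAt (L : ℕ) (b₀ p₀ : ℝ) : Prop :=
  ∃ γ₁ : ℝ, 0 < γ₁ ∧ ∀ (F : T3Family) (γ : ℝ), F.L = L → 0 < γ → γ ≤ γ₁ →
    ∀ (n : ℕ), ∃ cl : ℝ, 0 < cl ∧ ∀ (K : ℕ) (hK : n ≤ K),
      ∀ᵐ V ∂(fieldMeasure (F.P n) 0 (Matrix.specialUnitaryGroup (Fin 2) ℂ)),
        PlaqSmall (θBal F.L γ b₀ p₀ n) V →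
          cl ≤ (partitionFn (G := Matrix.specialUnitaryGroup (Fin 2) ℂ) (F.P K) ((F.scheme ℰp γ).β K))⁻¹ *
            heightDensity F γ hK (histGood F ℰp (θBal F.L γ b₀ p₀) K n) V

/-- The rows of record ARE the threshold closures of the fixed-profile rows (definitional). -/
theorem stabilityLowerWindowCan_iff_at :
    StabilityLowerWindowCan ↔ ∀ (L : ℕ), ∃ bB pB : ℝ, ∀ (b₀ p₀ : ℝ), bB ≤ b₀ → pB ≤ p₀ → StabilityLowerWindowAt L b₀ p₀ :=
  Iff.rfl

theorem smallHistoryLowerWindowCan_iff_at :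
    SmallHistoryLowerWindowCan ↔ ∀ (L : ℕ), ∃ bB pB : ℝ, ∀ (b₀ p₀ : ℝ), bB ≤ b₀ → pB ≤ p₀ → SmallHistoryLowerWindowAt L b₀ p₀ :=
  Iff.rfl

/-- The junction at EVERY fixed profile (same proof as ★ `stabilityLowerWindow_of_smallHistory`): LOWˢ∘-at ⇒ LOWB∘-at.  So the witness
below is consistent: LOWB∘-at may hold where LOWˢ∘-at fails, never conversely. Nothing of Bałaban's is proved. -/
theorem stabilityLowerWindowAt_of_smallHistoryAt {L : ℕ} {b₀ p₀ : ℝ} (h : SmallHistoryLowerWindowAt L b₀ p₀) :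
    StabilityLowerWindowAt L b₀ p₀ := by
  obtain ⟨γ₁, hγ₁, h1⟩ := h
  refine ⟨γ₁, hγ₁, fun F γ hFL hγ hγle n => ?_⟩
  obtain ⟨cl, hcl, h2⟩ := h1 F γ hFL hγ hγle n
  refine ⟨cl, hcl, fun K hK => ?_⟩
  have hmono := heightDensity_mono_ae (F := F) hK
    (measurableSet_histGood F ℰp measurableE_ℰp (θBal F.L γ b₀ p₀) K n) MeasurableSet.univ (Set.subset_univ _) hγ.le
  have hZ : 0 ≤ (partitionFn (G := Matrix.specialUnitaryGroup (Fin 2) ℂ) (F.P K) ((F.scheme ℰp γ).β K))⁻¹ :=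
    inv_nonneg.mpr (partitionFn_pos' _ (F.scheme_β_nonneg ℰp hγ.le K)).le
  filter_upwards [h2 K hK, hmono] with V hV hm hsm
  exact (hV hsm).trans (mul_le_mul_of_nonneg_left hm hZ)

/-- The constant-window profile is `p₀ = 0`: `θBal L γ b₀ 0 i = √(γ·(L⁻¹)^i) · b₀`. -/
theorem θBal_profile_zero (L : ℕ) (γ b₀ : ℝ) (i : ℕ) :
    θBal L γ b₀ 0 i = Real.sqrt (γ * ((L : ℝ)⁻¹) ^ i) * b₀ := by
  simp [θBal, B10.pFun, Real.rpow_zero]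

/-- **WEAKNESS WITNESS (critic #461 P2) — PRINT'S PREDICTION, RECORDED NOT PROVED.**  At the constant-window profile `p₀ = 0` (every `b₀`,
every `L`): LOWB∘-at HOLDS (its floor is on `ρ^{univ}` and its window sits on the datum only — inside print's (4) window `ε₁ = g·p(g)`, so
(5)-lower applies) while LOWˢ∘-at FAILS: with windows of CONSTANT width `b₀` in `g_j`-units at EVERY finer level `j = n+1, …, K`, the
union over the `24·L^{3(m+K−j)}` plaquettes of each level against a FIXED factor `e^{−c·b₀²}` diverges geometrically in `K − n`, so the
conditional mass of `histGood` under a window datum tends to `0` as `K → ∞` and — given UP∘ — `Z_K⁻¹ρ^{histGood}` has no `K`-uniform floor.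
SEPARATING THRESHOLD (instrument letter FL-8, sealed 08:10Z): a profile `θ_j` survives iff `Σ_{i ≥ 1} 24·L^{3(m+i)}·exp(−c·θ_{n+i}²∕g_{n+i}²)`
converges, i.e. iff `θ_j²∕g_j²` grows faster than `(3 log L∕c)·(j − n)`; print's `p(g_j)² = b₀²(1 + log g_j⁻¹)^{2p₀} ≥ b₀²(1 + (j log L)∕2)^{2p₀}`
passes for every `p₀ > ½` (and for `p₀ = ½` iff `b₀² log L > 6 log L∕c`), the constant profile `p₀ = 0` fails for every `b₀`.  A future refutation
of LOWˢ∘ at a sub-threshold profile must therefore NOT be read as evidence against LOWB∘.  This `def` is a RECORDED CONJECTURE (no stub, no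
`sorry`, consumed by nothing). [cite: Balaban1985UV3, (4)-(5) p.256, (7) p.257 and (47) p.267] -/
def LowerAntiReductionWitness : Prop :=
  (∀ (L : ℕ) (b₀ : ℝ), 1 < L → 0 < b₀ → StabilityLowerWindowAt L b₀ 0) ∧
    ¬ (∀ (L : ℕ) (b₀ : ℝ), 1 < L → 0 < b₀ → SmallHistoryLowerWindowAt L b₀ 0)

/-- By-name concluder: UP∘ from the two upper stubs (CONDITIONAL: the stubs are `sorry`d schemas). -/
theorem stabilityUpper_of_stubs : StabilityUpperCan :=
  stabilityUpper_of_histories stub_smallHistoryUpper stub_largeHistoryUpper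

/-- By-name concluder: LOWB∘ from the lower stub (CONDITIONAL: the stub is a `sorry`d schema). -/
theorem stabilityLowerWindow_of_stubs : StabilityLowerWindowCan :=
  stabilityLowerWindow_of_smallHistory stub_smallHistoryLowerWindow

end Summit.QuantumFields.YangMills.Cruxes.FluctuationComparisonRegPrIntL.HistorySplit

end
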